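/-
HONEST FRAMING: certified error envelopes and provably optimal rounding/accumulation schemes for
low-precision formats under stated cost models; every table by two implementations; no hardware
or vendor claims.
-/
import Summits.Ventures.CertifiedArithmetic.LowPrec.OptDemotionBudgetSound

/-!
# The demotion law (Theorem T8), part 7c: the DEMOTION CERTIFICATE theorem and all shapes

* `rlo q p m` (part 7a′) — the least value a nearest demotion into `F_p` can return for the budget
  mantissa `m` (in units of the budget scale): `rlo_mul_le_fl`;
* `budgetCheck q p s` (part 7a′) — the finite check `Φ*_s(m) ≤ Q_s · rlo(m)` over the binade;
* **`exact_le_treeQf_mul_fl_of_budgetCheck`** — CONJECTURE D (`s ≤ Q_t · fl_p(ŝ)`, all nonnegative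
  `F(q, emin)` data, any nearest roundings, `1 ≤ p`, `p + 1 ≤ q`) for EVERY tree whose shape passes
  the check (below `F_p`'s normal range the demotion is exact and Theorem U takes over);
* `shapesN n` / `shapesUpTo N` (part 7a′) — all (ordered) shapes with `n` / at most `N` leaves:
  COMPLETENESS `mem_shapesN` (a certificate over the list covers every tree of that size) and the
  Catalan count `shapesN_card`.
Kernel certificates in part 7d (`OptDemotionBudgetCert`).
-/

namespace Summit.Ventures.CertifiedArithmetic.LowPrec.Opt

open Literature.ComputerArithmetic.JeannerodRump2018
open Literature.ComputerArithmetic.JeannerodRump2018.SumTree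

/-! ## The demotion check (part 7c, §1)

At the scale `g = 2^(K+1-q)` of the computed root `v = m·g` (`m ∈ [2^(q-1), 2^q)`), a nearest
demotion into `F_p` (`p + 1 ≤ q`, `p`-grid spacing `2h·g`, `h = 2^(q-1-p)`) returns at least
`rlo(m)·g`: the `p`-grid point below `m` if `m` is within `h` of it, the one above otherwise.  So
`Φ*_t(m) ≤ Q_t · rlo(m)` for every `m` — a finite, kernel-decidable check on the shape — gives
`s ≤ Q_t · fl_p(ŝ)` for ALL data, by `exact_le_phi` (in the gradual-underflow range of `F_p` the
demotion is exact and Theorem U's `s ≤ M_t ŝ ≤ Q_t ŝ` takes over). -/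

/-- What the certificate says. -/
theorem budgetCheck_spec {q p : ℕ} {s : Shape} (h : budgetCheck q p s = true) {m : ℕ}
    (hm : 2 ^ (q - 1) ≤ m) (hm' : m < 2 ^ q) (hq : 1 ≤ q) :
    phi q s m ≤ treeQf (unitRoundoff q) s.toTree (unitRoundoff p) * (rlo q p m : ℚ) := by
  have hH := two_pow_eq_half_add_half hq
  simp only [budgetCheck, List.all_eq_true, List.mem_range, decide_eq_true_eq] at h
  have h1 := h (m - 2 ^ (q - 1)) (by omega)
  rw [show 2 ^ (q - 1) + (m - 2 ^ (q - 1)) = m by omega] at h1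
  exact h1

section Demote

variable {q : ℕ} {emin : ℤ} {fl : ℚ → ℚ}

/-- **THE DEMOTED VALUE IS AT LEAST `rlo(m)·g`.**  `1 ≤ p`, `p + 1 ≤ q`, `flp` any nearest rounding
into `F(p, emin)`, `m ∈ [2^(q-1), 2^q)`, `g = 2^(K+1-q)` with the `p`-grid spacing `2^(K+1-p) ≥ 2^emin`:
`rlo(m)·g ≤ flp(m·g)`. -/
theorem rlo_mul_le_fl {p : ℕ} (hp : 1 ≤ p) (hpq : p + 1 ≤ q) {flp : ℚ → ℚ}
    (hflp : IsRoundNearest p emin flp) {m : ℕ} (hm : 2 ^ (q - 1) ≤ m) (hm' : m < 2 ^ q) {K : ℤ}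
    (hK : emin + p ≤ K + 1) :
    (rlo q p m : ℚ) * (2 : ℚ) ^ (K + 1 - q) ≤ flp ((m : ℚ) * (2 : ℚ) ^ (K + 1 - q)) := by
  have h2 : (2 : ℚ) ≠ 0 := by norm_num
  set g := (2 : ℚ) ^ (K + 1 - q) with hg
  have hgpos : 0 < g := zpow_pos (by norm_num) _
  -- the p-grid at this scale: spacing D = 2h = 2^(q-p) (in units of g), i.e. 2^(K+1-p)
  obtain ⟨d, hd⟩ : ∃ d, q = p + d := ⟨q - p, by omega⟩
  have hd1 : 1 ≤ d := by omega
  have hD : 2 * 2 ^ (q - 1 - p) = 2 ^ d := by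
    rw [show q - 1 - p = d - 1 by omega, ← pow_succ']; congr 1; omega
  have hh : 2 ^ (q - 1 - p) = 2 ^ (d - 1) := by rw [show q - 1 - p = d - 1 by omega]
  have hD' : 2 * 2 ^ (d - 1) = 2 ^ d := by rw [← pow_succ']; congr 1; omega
  set n := m / 2 ^ d with hn
  have hrlo : rlo q p m = if m - n * 2 ^ d ≤ 2 ^ (d - 1) then n * 2 ^ d else n * 2 ^ d + 2 ^ d := by
    simp only [rlo, hh, hD', ← hn]
  have hDg : ((2 ^ d : ℕ) : ℚ) * g = (2 : ℚ) ^ (K + 1 - p) := by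
    push_cast; rw [hg, ← zpow_natCast, ← zpow_add₀ h2]; congr 1; rw [hd]; push_cast; ring
  -- n < 2^p, n ≥ 2^(p-1)
  have hnp : n < 2 ^ p := by
    rw [hn, Nat.div_lt_iff_lt_mul (by positivity), ← pow_add, ← hd]; exact hm'
  have hnp' : 2 ^ (p - 1) ≤ n := by
    rw [hn, Nat.le_div_iff_mul_le (by positivity), ← pow_add, show p - 1 + d = q - 1 by omega]; exact hm
  -- the two grid points x1 = n 2^(K+1-p) ≤ v and x2 = (n+1) 2^(K+1-p)
  have hx1F : IsFloat p emin ((n : ℚ) * (2 : ℚ) ^ (K + 1 - p)) :=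
    ⟨n, K + 1 - p, by rw [abs_of_nonneg (by positivity)]; exact_mod_cast hnp, by omega, by simp⟩
  have hx2F : IsFloat p emin (((n : ℚ) + 1) * (2 : ℚ) ^ (K + 1 - p)) := by
    rcases lt_or_eq_of_le (Nat.succ_le_of_lt hnp) with hlt | heq
    · exact ⟨n + 1, K + 1 - p, by rw [abs_of_nonneg (by positivity)]; exact_mod_cast hlt, by omega,
        by push_cast; ring⟩
    · have e : ((n : ℚ) + 1) * (2 : ℚ) ^ (K + 1 - p) = (2 : ℚ) ^ (K + 1) := by
        have : ((n : ℚ) + 1) = (2 : ℚ) ^ (p : ℤ) := by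
          rw [zpow_natCast]; exact_mod_cast heq
        rw [this, ← zpow_add₀ h2]; congr 1; ring
      rw [e]; exact PTree.isFloat_two_zpow hp (by omega)
  have hx1 : (n : ℚ) * (2 : ℚ) ^ (K + 1 - p) = ((n * 2 ^ d : ℕ) : ℚ) * g := by
    rw [← hDg]; push_cast; ring
  have hx2 : ((n : ℚ) + 1) * (2 : ℚ) ^ (K + 1 - p) = ((n * 2 ^ d + 2 ^ d : ℕ) : ℚ) * g := by
    rw [← hDg]; push_cast; ring
  have hrf_le : n * 2 ^ d ≤ m := Nat.div_mul_le_self m (2 ^ d)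
  have hx1_le : (n : ℚ) * (2 : ℚ) ^ (K + 1 - p) ≤ (m : ℚ) * g := by
    rw [hx1]; exact mul_le_mul_of_nonneg_right (by exact_mod_cast hrf_le) hgpos.le
  rw [hrlo]
  split_ifs with hcase
  · -- round down is possible: flp v ≥ x1
    have := le_fl_of_isFloat_le hflp hx1F hx1_le
    rw [hx1] at this; exact this
  · -- m is more than half a p-step above x1: flp v ≥ x2
    rw [not_le] at hcase
    by_contra hlt
    rw [not_le, ← hx2] at hlt
    -- flp v ≤ x1
    set v := (m : ℚ) * g with hv
    have hvx1 : (2 : ℚ) ^ K ≤ (n : ℚ) * (2 : ℚ) ^ (K + 1 - p) := by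
      have e : (2 : ℚ) ^ K = ((2 ^ (p - 1) : ℕ) : ℚ) * (2 : ℚ) ^ (K + 1 - p) := by
        push_cast; rw [← zpow_natCast, ← zpow_add₀ h2]; congr 1; push_cast [Nat.cast_sub hp]; ring
      rw [e]; exact mul_le_mul_of_nonneg_right (by exact_mod_cast hnp') (zpow_pos (by norm_num) _).le
    have hfl_le : flp v ≤ (n : ℚ) * (2 : ℚ) ^ (K + 1 - p) := by
      rcases lt_or_ge (flp v) ((2 : ℚ) ^ K) with hsmallf | hbigf
      · linarith
      · obtain ⟨N, hN⟩ := isFloat_grid (hflp v).1 hbigf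
        have e3 : ((n : ℚ) + 1) * (2 : ℚ) ^ (K + 1 - p)
            = (n : ℚ) * (2 : ℚ) ^ (K + 1 - p) + (2 : ℚ) ^ (K + 1 - p) := by ring
        exact grid_le_of_lt (zpow_pos (by norm_num) _) hN (B := (n : ℤ)) (by push_cast; ring)
          (by linarith)
    -- distances: v - flp v ≥ v - x1 > h g ≥ x2 - v ≥ |v - x2|
    have hnear := (hflp v).2 _ hx2F
    have hgap1 : ((2 ^ (d - 1) : ℕ) : ℚ) * g < v - (n : ℚ) * (2 : ℚ) ^ (K + 1 - p) := by
      rw [hx1, hv, ← sub_mul]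
      refine mul_lt_mul_of_pos_right ?_ hgpos
      have : ((2 ^ (d - 1) : ℕ) : ℚ) < ((m - n * 2 ^ d : ℕ) : ℚ) := by exact_mod_cast hcase
      rw [Nat.cast_sub hrf_le] at this; exact this
    have hgap2 : ((n : ℚ) + 1) * (2 : ℚ) ^ (K + 1 - p) - v < ((2 ^ (d - 1) : ℕ) : ℚ) * g := by
      rw [hx2, hv, ← sub_mul]
      refine mul_lt_mul_of_pos_right ?_ hgpos
      have h2d : 2 ^ d = 2 ^ (d - 1) + 2 ^ (d - 1) := two_pow_eq_half_add_half hd1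
      have : ((n * 2 ^ d + 2 ^ d : ℕ) : ℚ) - m < ((2 ^ (d - 1) : ℕ) : ℚ) := by
        have h3 : n * 2 ^ d + 2 ^ d < 2 ^ (d - 1) + m := by omega
        have h4 : ((n * 2 ^ d + 2 ^ d : ℕ) : ℚ) < ((2 ^ (d - 1) + m : ℕ) : ℚ) := by exact_mod_cast h3
        push_cast at h4 ⊢; linarith
      exact this
    have hvx2 : v < ((n : ℚ) + 1) * (2 : ℚ) ^ (K + 1 - p) := by
      rw [hx2, hv]
      refine mul_lt_mul_of_pos_right ?_ hgpos
      exact_mod_cast (Nat.lt_div_mul_add (a := m) (b := 2 ^ d) (by positivity))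
    rw [abs_of_nonneg (by linarith), abs_of_nonpos (by linarith)] at hnear
    linarith

/-- `M_t ≤ Q_t` and `0 ≤ Q_t` (`Q_t = treeQf u t P`, `P > 0`). -/
theorem treeM_le_treeQf {u : ℚ} (hu : 0 < u) (hu1 : u ≤ 1) (t : SumTree) {P : ℚ} (hP : 0 < P) :
    treeM u t ≤ treeQf u t P ∧ 0 ≤ treeQf u t P := by
  have h := allLine_le_treeQf hu t _ (mu_mem_allLines hu.le hu1 t) P hP
  have hM := one_le_treeM hu.le t
  simp only [zero_mul, add_zero] at h
  constructor <;> linarith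

/-- **CONJECTURE D FROM THE CERTIFICATE.**  `1 ≤ p`, `p + 1 ≤ q`, ANY nearest roundings `fl` into
`F(q, emin)` and `flp` into `F(p, emin)`, `t` any summation tree of nonnegative `F(q, emin)` data whose
SHAPE passes `budgetCheck q p`: the wide evaluation demoted once satisfies `s ≤ Q_t · fl_p(ŝ)`. -/
theorem exact_le_treeQf_mul_fl_of_budgetCheck {p : ℕ} (hp : 1 ≤ p) (hpq : p + 1 ≤ q) {flp : ℚ → ℚ}
    (hfl : IsRoundNearest q emin fl) (hflp : IsRoundNearest p emin flp) (t : SumTree)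
    (ht : ∀ x ∈ leaves t, IsFloat q emin x ∧ 0 ≤ x) (hc : budgetCheck q p (shapeOf t) = true) :
    exact t ≤ treeQf (unitRoundoff q) t (unitRoundoff p) * flp (eval fl t) := by
  have hq : 1 ≤ q := by omega
  set u := unitRoundoff q with hu
  set P := unitRoundoff p with hPdef
  have hupos : 0 < u := by rw [hu]; unfold unitRoundoff; positivity
  have hu1 : u ≤ 1 := unitRoundoff_le_one q
  have hP0 : 0 < P := by rw [hPdef]; unfold unitRoundoff; positivity
  obtain ⟨hMQ, hQ0⟩ := treeM_le_treeQf hupos hu1 t hP0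
  obtain ⟨hzero, hposb⟩ := exact_le_phi hq hfl t ht
  obtain ⟨hvF, hv0⟩ := eval_isFloat_nonneg hfl t ht
  set v := eval fl t with hv
  rcases eq_or_lt_of_le hv0 with h0 | hpos
  · rw [← h0, fl_eq_self hflp (isFloat_zero p emin), mul_zero]; exact hzero h0.symm
  · by_cases hsmall : v < (2 : ℚ) ^ (emin + p)
    · -- exact demotion: Theorem U
      rw [fl_eq_self hflp (isFloat_narrow_of_small hvF hv0 hsmall)]
      calc exact t ≤ treeM u t * v := exact_le_treeM_mul_eval_roundNearest hq hfl t ht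
        _ ≤ treeQf u t P * v := mul_le_mul_of_nonneg_right hMQ hv0
    · rw [not_lt] at hsmall
      set K := Int.log 2 v with hK
      have hvhi : v < ((2 : ℕ) : ℚ) ^ (K + 1) := Int.lt_zpow_succ_log_self (by norm_num) v
      push_cast at hvhi
      have hKe : emin + p ≤ K + 1 := by
        by_contra hc'
        have : (2 : ℚ) ^ (K + 1) ≤ (2 : ℚ) ^ (emin + (p : ℤ)) := zpow_le_zpow_right₀ (by norm_num) (by omega)
        linarith
      obtain ⟨hvcan, hm, hm'⟩ := float_canon hq hvF hpos
      set m := mant q v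
      set g := (2 : ℚ) ^ (K + 1 - q) with hg
      have hgpos : 0 < g := zpow_pos (by norm_num) _
      have h1 := hposb hpos
      have h2 := budgetCheck_spec hc hm hm' hq
      rw [treeQf_toTree_shapeOf] at h2
      have h3 := rlo_mul_le_fl hp hpq hflp hm hm' hKe
      rw [← hg, ← hvcan] at h3
      calc exact t ≤ g * phi q (shapeOf t) m := h1
        _ ≤ g * (treeQf u t P * rlo q p m) := mul_le_mul_of_nonneg_left h2 hgpos.le
        _ = treeQf u t P * ((rlo q p m : ℚ) * g) := by ring
        _ ≤ treeQf u t P * flp v := mul_le_mul_of_nonneg_left h3 hQ0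

end Demote

/-! ## All shapes with a given number of leaves (part 7c, §2) -/

/-- `shapeTab n` has `n + 1` entries. -/
theorem shapeTab_length : ∀ n : ℕ, (shapeTab n).length = n + 1
  | 0 => rfl
  | n + 1 => by simp [shapeTab, shapeTab_length n]

/-- Earlier entries are stable: entry `k ≤ n` of `shapeTab n` is `shapesN k`. -/
theorem shapeTab_getD : ∀ n k : ℕ, k ≤ n → (shapeTab n).getD k [] = shapesN k
  | 0, k, hk => by
      have : k = 0 := by omega
      subst this; rfl
  | n + 1, k, hk => by
      rcases Nat.lt_or_eq_of_le hk with hlt | rfl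
      · rw [← shapeTab_getD n k (by omega)]
        simp only [shapeTab, List.getD_eq_getElem?_getD]
        rw [List.getElem?_append_left (by rw [shapeTab_length]; omega)]
      · rfl

/-- The node rule: for `n ≥ 1`, the shapes with `n + 1` leaves are the `nd a b` with `a` of `k` and
`b` of `n + 1 - k` leaves. -/
theorem shapesN_succ {n : ℕ} (hn : n ≠ 0) :
    shapesN (n + 1) = (List.range (n + 1)).flatMap fun k =>
      (shapesN k).flatMap fun a => (shapesN (n + 1 - k)).map fun b => Shape.nd a b := by
  have h1 : shapesN (n + 1) = (if n = 0 then [Shape.lf] else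
        (List.range (n + 1)).flatMap fun k =>
          ((shapeTab n).getD k []).flatMap fun a =>
            ((shapeTab n).getD (n + 1 - k) []).map fun b => Shape.nd a b) := by
    simp only [shapesN, shapeTab, List.getD_eq_getElem?_getD]
    rw [List.getElem?_append_right (by rw [shapeTab_length])]
    simp [shapeTab_length]
  rw [h1, if_neg hn]
  apply List.flatMap_congr
  intro k hk
  rw [List.mem_range] at hk
  rw [shapeTab_getD n k (by omega)]
  rcases Nat.eq_zero_or_pos k with rfl | hkpos
  · simp [shapesN, shapeTab]
  · rw [shapeTab_getD n (n + 1 - k) (by omega)]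

/-- A shape has at least one leaf. -/
theorem Shape.numLeaves_pos : ∀ s : Shape, 1 ≤ s.numLeaves
  | .lf => le_rfl
  | .nd a _ => le_trans a.numLeaves_pos (Nat.le_add_right _ _)

/-- COMPLETENESS: every shape is listed among the shapes with its number of leaves. -/
theorem mem_shapesN : ∀ s : Shape, s ∈ shapesN s.numLeaves
  | .lf => by decide
  | .nd a b => by
      have ha := mem_shapesN a
      have hb := mem_shapesN b
      have hna := a.numLeaves_pos
      have hnb := b.numLeaves_pos
      simp only [Shape.numLeaves]
      obtain ⟨n, hn⟩ : ∃ n, a.numLeaves + b.numLeaves = n + 1 := ⟨a.numLeaves + b.numLeaves - 1, by omega⟩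
      rw [hn, shapesN_succ (by omega)]
      simp only [List.mem_flatMap, List.mem_range, List.mem_map]
      refine ⟨a.numLeaves, by omega, a, ha, b, ?_, rfl⟩
      rw [show n + 1 - a.numLeaves = b.numLeaves by omega]; exact hb

/-- Every shape with at most `N` leaves is in `shapesUpTo N`. -/
theorem mem_shapesUpTo {s : Shape} {N : ℕ} (h : s.numLeaves ≤ N) : s ∈ shapesUpTo N := by
  simp only [shapesUpTo, List.mem_flatMap, List.mem_range]
  exact ⟨s.numLeaves, by omega, mem_shapesN s⟩

/-- The number of leaves of the shape is the number of summands. -/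
theorem numLeaves_shapeOf : ∀ t : SumTree, (shapeOf t).numLeaves = (leaves t).length
  | .leaf _ => rfl
  | .node a b => by
      simp only [shapeOf_node, Shape.numLeaves, leaves, List.length_append, numLeaves_shapeOf a,
        numLeaves_shapeOf b]

/-- From a certificate over `shapesUpTo N` to every tree with at most `N` summands. -/
theorem budgetCheck_of_all {q p N : ℕ} (h : (shapesUpTo N).all (budgetCheck q p) = true)
    (t : SumTree) (hn : (leaves t).length ≤ N) : budgetCheck q p (shapeOf t) = true := by
  rw [List.all_eq_true] at h
  exact h _ (mem_shapesUpTo (by rw [numLeaves_shapeOf]; exact hn))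

/-- Counting check: the numbers of (ordered) shapes with `1 … 8` leaves are the Catalan numbers. -/
theorem shapesN_card : ((List.range 9).map fun n => (shapesN n).length) = [0, 1, 1, 2, 5, 14, 42, 132, 429] := by
  decide +kernel

end Summit.Ventures.CertifiedArithmetic.LowPrec.Opt
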